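import Literature.NumberTheory.EllipticCurves.RingClassFieldClassNumber
import Literature.NumberTheory.EllipticCurves.RingClassFieldGenusDiscriminantProofs
import Literature.NumberTheory.EllipticCurves.HeegnerPointsOfConductorOneRationalityProofs
import Literature.NumberTheory.NumberFields.HilbertClassFieldIdelic
import Literature.NumberTheory.NumberFields.BauerSplitPrimes
import Literature.NumberTheory.ComplexMultiplication.EllipticUnits.KroneckerLimitFormulaGenusCharacters
import HarnessLib

/-!
# Route `PrintCf2`, crux stmt-BirchSwinnertonDyer-20509 `RamifiedOffTYZOfFacts`, THEOREM A's target (T0): the BRIDGE between the Hilbert class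
# field `H ⊆ K^{(𝔪)} ⊆ K̄` of the tree's class field theory and the field of singular moduli `K[1] = H_K ⊂ ℂ` of the tree's complex
# multiplication — `e(H) = K[1]` for every embedding `e : K^{(𝔪)} → ℂ` over `ι`
# (cell `bsd-print-cf2`, LEAD cruxlead-20509 g33, line `offtyz-v7`, lineage cycle 34; fact-free, Theses-free, `def`-free)

HONEST FRAMING (`--supports stmt-BirchSwinnertonDyer-20509`; theorems only, no `sorry`, no new named fact).  BSD is not proved by any of this;
no class is closed by this file; item 23431 (C⁺) and crux 20509 stay OPEN.  THEOREM A's kernel road (memo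
`Cruxes/RamifiedOffTYZOfFacts/Lines/offtyz_v7_TheoremARoad.md` §3c; `TheoremATargets.orbitProd_sq_of_targets`, p812073) computes with Artin symbols in
the ray class field `R = rayClassField K (32) ⊆ K̄` (`TheoremAReciprocity`, p811633) while every CM input — the Heegner point `(X(τ), Y(τ)) = φ(τ_Q)`,
the genus square root `√l`, the Galois action on Heegner points — is a theorem of the tree about SUBFIELDS OF `ℂ` (`singularModuliField K ι`,
`ringClassField K ι 1`).  This file is the dictionary between the two worlds, for `K` imaginary quadratic, `ι : K → ℂ`, `𝔪 ≠ 0`, and an embedding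
`e : rayClassField K 𝔪 → ℂ` over `ι`:

* `primeClass_one_eq_one_of_isPrincipal` — a principal prime has trivial class in `I_K(1)/P_{K,ℤ}(1)`;
* ★ `exists_algEquiv_hilbertClassField_ringClassField` — **`hilbertClassField K ≃ₐ[K] ringClassField K ι 1`**: the class-field copy `R₁ ⊆ K̄`
  of `K[1]` (tree `exists_classField_algEquiv_ringClassField`, Cox Thm. 11.1) IS the Hilbert class field (Bauer: the primes split in `H` are the
  principal ones, which split in `R₁`; equal degrees `h_K`);
* `hilbertClassField_le_rayClassField` — `H ≤ rayClassField K 𝔪` (`rayClassField K ⊤ = H` and antitonicity);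
* ★★ `exists_algEquiv_coe_eq` — **THE BRIDGE**: there is a `K`-isomorphism `φ : H ≃ₐ[K] K[1]` with `φ h = e h` in `ℂ` for every `h ∈ H ⊆ R`
  (a `K`-embedding of `K[1]` into `ℂ` permutes the roots of the class equation, so its image is `K[1]` again);
  `mem_singularModuliField_iff` — `x ∈ H_K ⊂ ℂ` iff `x = e h` for some `h ∈ H`;
* corollaries for THEOREM A: `exists_mem_sq_eq_natCast_of_dvd_discr` — for an odd prime `q ∣ d_K`, `q ≡ 1 (mod 4)`, some `w ∈ H ⊆ R` has
  `w² = q` (Gauss's genus theory, tree `sqrt_primeStar_mem_ringClassField_one`); `exists_point_map_eq_phi` — every Heegner point `φ(τ_Q)` of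
  conductor `1` is `e` of a point of `W(R)` with coordinates in `H` (Darmon Thm. 3.6, tree `phi_heegnerTau_mem_range_map_singularModuliField_holds`);
  `exists_sq_eq_neg_one_rayClassField` — `ζ₄ ∈ rayClassField K (32)` (Neukirch VI (6.7), tree `mem_rayClassField_of_pow_eq_one`).

References: [cite: Cox2013, Thm. 11.1, Cor. 11.34, Thm. 8.10, Cor. 5.21, Thm. 6.1]; [cite: NeukirchANT1999, Ch. VI (6.2), (6.7), (6.9); Ch. VII (13.9)];
[cite: Darmon2004, Thm. 3.6]; tree p811633/p811823 (R1)/(R0), memo §3c.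
-/

noncomputable section

open scoped Classical
open NumberField IsDedekindDomain Polynomial

namespace Summit.BirchSwinnertonDyer.PrintCf2.TheoremAHilbertBridge

open Literature.NumberTheory.EllipticCurves Literature.NumberTheory.NumberFields Literature.NumberTheory.GaloisRepresentations
open Literature.NumberTheory.NumberFields.RingClassField Literature.NumberTheory.EllipticCurves.ModularForms
open Literature.NumberTheory.QuadraticFields.Quadratic
open Literature.NumberTheory.ComplexMultiplication.EllipticUnits

variable {K : Type} [Field K] [NumberField K]

/-! ## §1 Principal primes have trivial class in `I_K(1)/P_{K,ℤ}(1)` -/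

/-- The class `[I]` only depends on the ideal `I`. [folklore] -/
theorem idealClass_congr (f : ℕ) {I J : Ideal (𝓞 K)} (hIJ : I = J) (hI : I ≠ ⊥) (hJ : J ≠ ⊥)
    (hIc : I ⊔ Ideal.span {(f : 𝓞 K)} = ⊤) (hJc : J ⊔ Ideal.span {(f : 𝓞 K)} = ⊤) :
    idealClass f hI hIc = idealClass f hJ hJc := by
  subst hIJ; rfl

/-- **A principal prime `𝔭 = (α)` has trivial class in `I_K(1)/P_{K,ℤ}(1)`** (`α ≡ 1 (mod 1·𝓞_K)` vacuously).
[cite: Cox2013, §7.C Prop. 7.22 (P_{K,ℤ}(f) for f = 1)] -/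
theorem primeClass_one_eq_one_of_isPrincipal (v : HeightOneSpectrum (𝓞 K)) (hv : v.asIdeal.IsPrincipal) :
    primeClass 1 v = 1 := by
  obtain ⟨α, hα⟩ := hv
  have hα' : v.asIdeal = Ideal.span {α} := by rw [hα]
  have hα0 : α ≠ 0 := by
    rintro rfl
    exact v.ne_bot (by rw [hα', Ideal.span_singleton_eq_bot])
  have h1 : (Ideal.span {((1 : ℕ) : 𝓞 K)} : Ideal (𝓞 K)) = ⊤ := by
    rw [Nat.cast_one, Ideal.span_singleton_one]
  have hcop : v.asIdeal ⊔ Ideal.span {((1 : ℕ) : 𝓞 K)} = ⊤ := by rw [h1, sup_top_eq]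
  have hcop' : Ideal.span {α} ⊔ Ideal.span {((1 : ℕ) : 𝓞 K)} = ⊤ := by rw [h1, sup_top_eq]
  have hJ : Ideal.span {α} ≠ ⊥ := by rw [Ne, Ideal.span_singleton_eq_bot]; exact hα0
  rw [primeClass_of_sup_eq_top 1 hcop, idealClass_congr 1 hα' v.ne_bot hJ hcop hcop']
  exact idealClass_span_eq_one 1 hα0 (a := 1) isCoprime_one_left (by rw [h1]; exact Submodule.mem_top) hcop'

/-! ## §2 The class-field copy of `K[1]` is the Hilbert class field -/

/-- ★ **`hilbertClassField K ≃ₐ[K] ringClassField K ι 1`** for `K` imaginary quadratic: the ring class field of conductor `1` realised in `ℂ`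
(singular moduli) is `K`-isomorphic to the Hilbert class field inside `K̄`.  The tree's class-field copy `R₁ ⊆ K̄` of `K[1]` (finite Galois,
unramified everywhere, `v` split iff `[𝔭_v] = 1` in `I_K(1)/P_{K,ℤ}(1)`) is contained in `H` by Bauer's theorem (a prime split in `H` is
principal, hence has trivial class, hence splits in `R₁`) and has the same degree `h_K`, so it IS `H`.
[cite: Cox2013, Thm. 11.1 and Cor. 11.34, Thm. 8.10] [cite: NeukirchANT1999, Ch. VII Prop. (13.9)] -/
theorem exists_algEquiv_hilbertClassField_ringClassField (hK : IsImaginaryQuadratic K) (ι : K →+* ℂ) :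
    Nonempty (hilbertClassField K ≃ₐ[K] ringClassField K ι 1) := by
  obtain ⟨R₁, hfd, hgal, -, hsplit, ⟨φ⟩⟩ := exists_classField_algEquiv_ringClassField hK ι one_ne_zero
  haveI := hfd
  haveI := hgal
  haveI : NumberField R₁ := NumberField.of_module_finite K R₁
  set Ω := AlgebraicClosure K
  set H := hilbertClassField K with hHdef
  -- every prime split in `H` splits in `R₁`
  have hsub : ∀ v : HeightOneSpectrum (𝓞 K), v ∈ splitPrimes K H → v ∈ splitPrimes K R₁ := by
    intro v hv
    have hprin := (hilbertClassField.mem_splitPrimes_iff_isPrincipal K v).mp hv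
    refine (hsplit v ?_).mpr (primeClass_one_eq_one_of_isPrincipal v hprin)
    rw [Nat.cast_one, Ideal.span_singleton_one]
    exact fun h => v.isPrime.ne_top (top_le_iff.mp h)
  -- Bauer in the compositum `M = H R₁`
  set M : IntermediateField K Ω := H ⊔ R₁ with hMdef
  haveI : FiniteDimensional K M := IntermediateField.finiteDimensional_sup H R₁
  haveI : Normal K M := inferInstance
  haveI : IsGalois K M := IsGalois.mk
  haveI : NumberField M := NumberField.of_module_finite K M
  set F₁ : IntermediateField K M := IntermediateField.restrict (le_sup_left : H ≤ M) with hF₁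
  set F₂ : IntermediateField K M := IntermediateField.restrict (le_sup_right : R₁ ≤ M) with hF₂
  haveI : IsGalois K F₁ := IsGalois.of_algEquiv (IntermediateField.restrict_algEquiv _)
  haveI : IsGalois K F₂ := IsGalois.of_algEquiv (IntermediateField.restrict_algEquiv _)
  haveI : NumberField F₁ := NumberField.of_module_finite K F₁
  haveI : NumberField F₂ := NumberField.of_module_finite K F₂
  have hF : F₂ ≤ F₁ := by
    refine le_of_splitPrimes_subset F₁ F₂ (Filter.Eventually.of_forall fun v hv => ?_)
    rw [← splitPrimes_eq_of_algEquiv (IntermediateField.restrict_algEquiv (le_sup_right : R₁ ≤ M))]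
    rw [← splitPrimes_eq_of_algEquiv (IntermediateField.restrict_algEquiv (le_sup_left : H ≤ M))] at hv
    exact hsub v hv
  have h1 : IntermediateField.lift F₁ = H := IntermediateField.lift_restrict _
  have h2 : IntermediateField.lift F₂ = R₁ := IntermediateField.lift_restrict _
  have hle : R₁ ≤ H := by
    rw [← h1, ← h2]
    rintro _ ⟨y, hy, rfl⟩
    exact ⟨y, hF hy, rfl⟩
  -- equal degrees
  have hdeg : Module.finrank K R₁ = Module.finrank K H := by
    rw [LinearEquiv.finrank_eq φ.toLinearEquiv, finrank_ringClassField_eq_classNumber hK ι one_ne_zero, Nat.cast_one, one_pow,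
      one_mul, card_reducedForms_eq_classNumber hK.1 hK.discr_neg, hHdef, hilbertClassField.finrank_eq_classNumber]
  have heq : R₁ = H := IntermediateField.eq_of_le_of_finrank_eq hle hdeg
  exact ⟨(IntermediateField.equivOfEq heq.symm).trans φ⟩

/-! ## §3 `H ≤ K^{(𝔪)}` -/

/-- **`hilbertClassField K ≤ rayClassField K 𝔪`** for every `𝔪 ≠ 0` (`H = K^{(1)}` and `K^{(1)} ⊆ K^{(𝔪)}`).
[cite: NeukirchANT1999, Ch. VI §6 Def. (6.2) and Prop. (6.9)] -/
theorem hilbertClassField_le_rayClassField {𝔪 : Ideal (𝓞 K)} (h𝔪 : 𝔪 ≠ ⊥) : hilbertClassField K ≤ rayClassField K 𝔪 := by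
  rw [← hilbertClassField.rayClassField_top_eq_hilbertClassField K]
  exact rayClassField_mono (rayUnitIdeles_anti_of_le h𝔪 le_top)

/-! ## §4 THE BRIDGE: `e(H) = K[1]` -/

/-- A ring homomorphism `χ : K[1] → ℂ` over `ι` maps `K[1]` INTO `K[1]`: it fixes `ι(K)` and sends every singular modulus (a root of the class
equation `H_{d_K} ∈ ℚ[X]`) to a singular modulus. [cite: Cox2013, §13.A Prop. 13.2 and Thm. 11.1] -/
theorem apply_mem_ringClassField_one (hK : IsImaginaryQuadratic K) (ι : K →+* ℂ) (χ : ringClassField K ι 1 →+* ℂ)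
    (hχ : ∀ k : K, χ (algebraMap K (ringClassField K ι 1) k) = ι k) (x : ringClassField K ι 1) : χ x ∈ ringClassField K ι 1 := by
  -- the set of elements of `K[1]` mapped into `K[1]` is a subfield containing the generators
  let T : Subfield ℂ := ((ringClassField K ι 1).comap χ).map (ringClassField K ι 1).subtype
  have hT : ∀ y : ℂ, y ∈ T ↔ ∃ hy : y ∈ ringClassField K ι 1, χ ⟨y, hy⟩ ∈ ringClassField K ι 1 := by
    intro y
    simp only [T, Subfield.mem_map, Subfield.mem_comap, Subfield.coe_subtype]
    constructor
    · rintro ⟨⟨y, hy⟩, h, rfl⟩; exact ⟨hy, h⟩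
    · rintro ⟨hy, h⟩; exact ⟨⟨y, hy⟩, h, rfl⟩
  have hgen : ringClassField K ι 1 ≤ T := by
    rw [ringClassField, Subfield.closure_le]
    rintro y (⟨k, rfl⟩ | hy)
    · refine (hT _).mpr ⟨apply_mem_ringClassField ι 1 k, ?_⟩
      have : (⟨ι k, apply_mem_ringClassField ι 1 k⟩ : ringClassField K ι 1) = algebraMap K (ringClassField K ι 1) k := rfl
      rw [this, hχ]
      exact apply_mem_ringClassField ι 1 k
    · have hy' : y ∈ ringClassField K ι 1 := ringClassSingularModuli_subset_ringClassField ι 1 hy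
      refine (hT _).mpr ⟨hy', ?_⟩
      -- `y = j(τ_Q)` is a root of `H_{d_K} = (minpoly ℚ y).map`, and so is `χ y`
      rw [ringClassSingularModuli_one] at hy
      obtain ⟨Q, hQ, rfl⟩ := Finset.mem_image.mp hy
      have hmin := minpoly_formJ_map_eq_classPolynomial hK.discr_neg hQ
      -- `χ y` is a root of `H_{d_K} = p.map`, `p = minpoly ℚ y ∈ ℚ[X]`
      set p : ℚ[X] := minpoly ℚ (formJ Q) with hp
      set y : ringClassField K ι 1 := ⟨formJ Q, hy'⟩ with hydef
      have hrat : ∀ (L : Type) [Field L] [CharZero L] (f g : ℚ →+* L), f = g := fun L _ _ f g => Subsingleton.elim f g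
      -- `p(y) = 0` in `K[1]`
      have h0 : (p.map (algebraMap ℚ (ringClassField K ι 1))).eval y = 0 := by
        apply (ringClassField K ι 1).subtype.injective
        rw [map_zero, Polynomial.eval_map, Polynomial.hom_eval₂,
          hrat ℂ ((ringClassField K ι 1).subtype.comp (algebraMap ℚ (ringClassField K ι 1))) (algebraMap ℚ ℂ),
          ← Polynomial.eval_map, hmin]
        show (classPolynomial (NumberField.discr K)).eval (formJ Q) = 0
        rw [← hmin, Polynomial.eval_map, ← Polynomial.aeval_def]
        exact minpoly.aeval ℚ (formJ Q)
      have hroot : (classPolynomial (NumberField.discr K)).eval (χ y) = 0 := by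
        have h1 := congrArg χ h0
        rw [map_zero, Polynomial.eval_map, Polynomial.hom_eval₂, hrat ℂ (χ.comp (algebraMap ℚ (ringClassField K ι 1))) (algebraMap ℚ ℂ),
          ← Polynomial.eval_map, hmin] at h1
        exact h1
      obtain ⟨Q', hQ', hQQ'⟩ := Finset.mem_image.mp (mem_image_formJ_of_eval_classPolynomial hroot)
      have hy1 : χ y ∈ ringClassField K ι 1 := by
        rw [← hQQ', ringClassField_one]
        exact formJ_mem_singularModuliField_of_mem_reducedForms ι hQ'
      exact hy1
  exact ((hT _).mp (hgen x.2)).2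

/-- ★★ **THE BRIDGE `e(H) = K[1]`.**  For `K` imaginary quadratic, `ι : K → ℂ`, `𝔪 ≠ 0` and an embedding `e : rayClassField K 𝔪 → ℂ` over `ι`, there
is a `K`-isomorphism `φ : hilbertClassField K ≃ₐ[K] ringClassField K ι 1` COMPATIBLE with `e`: `(φ h : ℂ) = e h` for every `h ∈ H ⊆ rayClassField K 𝔪`.
(Any `K`-isomorphism `φ₀`; the `K`-embedding `e ∘ φ₀⁻¹ : K[1] → ℂ` lands in `K[1]` and is onto it, i.e. is a `K`-automorphism `χ` of `K[1]`;
take `φ = χ ∘ φ₀`.) [cite: Cox2013, Thm. 11.1 and Cor. 11.34] [cite: NeukirchANT1999, Ch. VI §6 Prop. (6.9)] -/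
theorem exists_algEquiv_coe_eq (hK : IsImaginaryQuadratic K) (ι : K →+* ℂ) {𝔪 : Ideal (𝓞 K)} (h𝔪 : 𝔪 ≠ ⊥)
    (e : rayClassField K 𝔪 →+* ℂ) (he : ∀ k : K, e (algebraMap K (rayClassField K 𝔪) k) = ι k) :
    ∃ φ : hilbertClassField K ≃ₐ[K] ringClassField K ι 1,
      ∀ h : hilbertClassField K, ((φ h : ringClassField K ι 1) : ℂ) = e (IntermediateField.inclusion (hilbertClassField_le_rayClassField h𝔪) h) := by
  obtain ⟨φ₀⟩ := exists_algEquiv_hilbertClassField_ringClassField hK ι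
  haveI := (finiteDimensional_and_isGalois_ringClassField hK ι one_ne_zero).1
  set incl := IntermediateField.inclusion (hilbertClassField_le_rayClassField (K := K) h𝔪) with hincl
  -- `χ = e ∘ incl ∘ φ₀⁻¹ : K[1] → ℂ`, over `ι`
  let χ : ringClassField K ι 1 →+* ℂ := (e.comp incl.toRingHom).comp φ₀.symm.toAlgHom.toRingHom
  have hχapply : ∀ x, χ x = e (incl (φ₀.symm x)) := fun x => rfl
  have hχK : ∀ k : K, χ (algebraMap K (ringClassField K ι 1) k) = ι k := by
    intro k
    rw [hχapply, AlgEquiv.commutes, AlgHom.commutes]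
    exact he k
  -- `χ` corestricts to a `K`-algebra endomorphism of `K[1]`, hence an automorphism
  have hmem : ∀ x, χ x ∈ ringClassField K ι 1 := apply_mem_ringClassField_one hK ι χ hχK
  let χ' : ringClassField K ι 1 →ₐ[K] ringClassField K ι 1 :=
    { toFun := fun x => ⟨χ x, hmem x⟩
      map_one' := Subtype.ext (by simp)
      map_mul' := fun x y => Subtype.ext (by simp)
      map_zero' := Subtype.ext (by simp)
      map_add' := fun x y => Subtype.ext (by simp)
      commutes' := fun k => Subtype.ext (by
        show χ (algebraMap K (ringClassField K ι 1) k) = ((algebraMap K (ringClassField K ι 1) k : ringClassField K ι 1) : ℂ)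
        rw [hχK]; rfl) }
  have hbij : Function.Bijective χ' := Algebra.IsAlgebraic.algHom_bijective χ'
  refine ⟨φ₀.trans (AlgEquiv.ofBijective χ' hbij), fun h => ?_⟩
  show χ (φ₀ h) = e (incl h)
  rw [hχapply, AlgEquiv.symm_apply_apply]

/-- **`x ∈ H_K = K[1] ⊂ ℂ` iff `x = e(h)` for some `h` in the Hilbert class field `H ⊆ rayClassField K 𝔪`.**
[cite: Cox2013, Cor. 11.34] -/
theorem mem_singularModuliField_iff (hK : IsImaginaryQuadratic K) (ι : K →+* ℂ) {𝔪 : Ideal (𝓞 K)} (h𝔪 : 𝔪 ≠ ⊥)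
    (e : rayClassField K 𝔪 →+* ℂ) (he : ∀ k : K, e (algebraMap K (rayClassField K 𝔪) k) = ι k) (x : ℂ) :
    x ∈ singularModuliField K ι ↔ ∃ h : hilbertClassField K, e (IntermediateField.inclusion (hilbertClassField_le_rayClassField h𝔪) h) = x := by
  obtain ⟨φ, hφ⟩ := exists_algEquiv_coe_eq hK ι h𝔪 e he
  rw [← ringClassField_one]
  constructor
  · intro hx
    refine ⟨φ.symm ⟨x, hx⟩, ?_⟩
    rw [← hφ, AlgEquiv.apply_symm_apply]
  · rintro ⟨h, rfl⟩
    rw [← hφ]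
    exact (φ h).2

/-! ## §5 Corollaries for THEOREM A -/

/-- **`√q ∈ H ⊆ rayClassField K 𝔪`** for an odd prime `q ∣ d_K` with `q ≡ 1 (mod 4)` (`q* = q`): Gauss's genus theory (tree
`sqrt_primeStar_mem_ringClassField_one`) read through the bridge.  For THEOREM A: `K = ℚ(√−lq)`, `q := l ≡ 1 (mod 8)`.
[cite: Cox2013, §6.A Thm. 6.1] -/
theorem exists_mem_sq_eq_natCast_of_dvd_discr (hK : IsImaginaryQuadratic K) (ι : K →+* ℂ) {𝔪 : Ideal (𝓞 K)} (h𝔪 : 𝔪 ≠ ⊥)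
    (e : rayClassField K 𝔪 →+* ℂ) (he : ∀ k : K, e (algebraMap K (rayClassField K 𝔪) k) = ι k)
    {q : ℕ} (hq : q.Prime) (hq4 : q % 4 = 1) (hqD : (q : ℤ) ∣ NumberField.discr K) :
    ∃ h : hilbertClassField K, (IntermediateField.inclusion (hilbertClassField_le_rayClassField h𝔪) h) ^ 2 = (q : rayClassField K 𝔪) := by
  have hq2 : q ≠ 2 := by rintro rfl; norm_num at hq4
  -- `√q ∈ ℂ` lies in `K[1]`
  have hstar : ((-1 : ℤ) ^ (q / 2) * q : ℤ) = q := by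
    have he : Even (q / 2) := ⟨q / 4, by omega⟩
    rw [he.neg_one_pow, one_mul]
  have hr : ((Real.sqrt q : ℝ) : ℂ) ^ 2 = ((((-1 : ℤ) ^ (q / 2) * q : ℤ)) : ℂ) := by
    rw [hstar, ← Complex.ofReal_pow, Real.sq_sqrt (Nat.cast_nonneg q)]; push_cast; rfl
  have hmem := sqrt_primeStar_mem_ringClassField_one hK ι hq hq2 hqD _ hr
  rw [ringClassField_one] at hmem
  obtain ⟨h, hh⟩ := (mem_singularModuliField_iff hK ι h𝔪 e he _).mp hmem
  refine ⟨h, e.injective ?_⟩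
  rw [map_pow, hh, map_natCast, ← Complex.ofReal_natCast, ← Complex.ofReal_pow, Real.sq_sqrt (Nat.cast_nonneg q)]

/-- `Subfield.inclusion` is the identity on underlying elements (stated for ABSTRACT subfields, so that the kernel never compares two concrete
subfields of `ℂ` definitionally). [folklore] -/
theorem coe_subfieldInclusion {L : Type*} [Field L] {S T : Subfield L} (h : S ≤ T) (x : S) : ((Subfield.inclusion h x : T) : L) = (x : L) := rfl

/-- Pushing a point along `f : A → B` and then along `g : B → ℂ` is pushing it along `u : A → ℂ` when `g ∘ f = u` (stated for ABSTRACT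
fields so that the kernel never compares concrete subfields of `ℂ` definitionally). [folklore] -/
theorem map_map_eq_map_of_comp_eq {A B : Type*} [Field A] [Algebra ℚ A] [Field B] [Algebra ℚ B] (W : WeierstrassCurve ℚ)
    (f : A →+* B) (g : B →+* ℂ) (u : A →+* ℂ) (hfg : ∀ a, g (f a) = u a) (P : (W.baseChange A).toAffine.Point) :
    WeierstrassCurve.Affine.Point.map g.toRatAlgHom (WeierstrassCurve.Affine.Point.map (W' := W) f.toRatAlgHom P) =
      WeierstrassCurve.Affine.Point.map u.toRatAlgHom P := by
  have hcomp : g.toRatAlgHom.comp f.toRatAlgHom = u.toRatAlgHom := AlgHom.ext fun a => hfg a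
  rw [WeierstrassCurve.Affine.Point.map_map, hcomp]

/-- **Heegner points of conductor `1` come from `H ⊆ rayClassField K 𝔪`**: for `W/ℚ` elliptic, a parametrisation datum `Dt` at level `N` and a
Heegner form `Q` of level `N` and discriminant `d_K`, `Dt.φ(τ_Q)` is the image under `e` of a point of `W` with coordinates in the Hilbert class field
(Darmon Thm. 3.6, tree theorem `phi_heegnerTau_mem_range_map_singularModuliField_holds`, through the bridge). [cite: Darmon2004, Thm. 3.6] -/
theorem exists_point_map_eq_phi (hK : IsImaginaryQuadratic K) (ι : K →+* ℂ) {𝔪 : Ideal (𝓞 K)} (h𝔪 : 𝔪 ≠ ⊥)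
    (e : rayClassField K 𝔪 →+* ℂ) (he : ∀ k : K, e (algebraMap K (rayClassField K 𝔪) k) = ι k)
    {N : ℕ} [NeZero N] {W : WeierstrassCurve ℚ} [W.IsElliptic] (Dt : ModularParametrizationData W N)
    {Q : ℤ × ℤ × ℤ} (hQ : Q ∈ heegnerForms N (NumberField.discr K)) :
    ∃ P : (W.baseChange (hilbertClassField K)).toAffine.Point,
      WeierstrassCurve.Affine.Point.map (e.comp (IntermediateField.inclusion (hilbertClassField_le_rayClassField h𝔪)).toRingHom).toRatAlgHom P =
        Dt.φ (heegnerTau Q) := by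
  obtain ⟨φ, hφ⟩ := exists_algEquiv_coe_eq hK ι h𝔪 e he
  obtain ⟨P, hP⟩ := phi_heegnerTau_mem_range_map_singularModuliField_holds N W K hK Dt ι hQ
  -- transport `P ∈ W(H_K)` along `H_K ⊆ K[1]` and `φ⁻¹ : K[1] → H`
  have hle : singularModuliField K ι ≤ ringClassField K ι 1 := (ringClassField_one ι).ge
  set incl := IntermediateField.inclusion (hilbertClassField_le_rayClassField (K := K) h𝔪) with hincl
  let ψ : singularModuliField K ι →+* hilbertClassField K := φ.symm.toAlgHom.toRingHom.comp (Subfield.inclusion hle)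
  have hfg : ∀ a, (e.comp incl.toRingHom) (ψ a) = (singularModuliField K ι).subtype a := by
    intro a
    show e (incl (φ.symm (Subfield.inclusion hle a))) = (a : ℂ)
    rw [← hφ, AlgEquiv.apply_symm_apply]
    exact coe_subfieldInclusion hle a
  refine ⟨WeierstrassCurve.Affine.Point.map (W' := W) ψ.toRatAlgHom P, ?_⟩
  exact (map_map_eq_map_of_comp_eq W ψ (e.comp incl.toRingHom) (singularModuliField K ι).subtype hfg P).trans hP

/-- **`ζ₄ ∈ rayClassField K (32)`** for `K` imaginary quadratic (`K(μ₄) ⊆ K^{(4)} ⊆ K^{(32)}`, Neukirch VI (6.7)): a square root of `−1` in the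
ray class field of modulus `32` — the element `e⁻¹(±i)` of THEOREM A's field `L₁ = K(i, √l)`. [cite: NeukirchANT1999, Ch. VI §6 Prop. (6.7)] -/
theorem exists_sq_eq_neg_one_rayClassField (hK : IsImaginaryQuadratic K) :
    ∃ i₀ : rayClassField K (Ideal.span {((32 : ℕ) : 𝓞 K)}), i₀ ^ 2 = -1 := by
  haveI := hK.isTotallyComplex
  have h32 : (Ideal.span {((32 : ℕ) : 𝓞 K)} : Ideal (𝓞 K)) ≠ ⊥ := by
    rw [Ne, Ideal.span_singleton_eq_bot]; exact_mod_cast (by norm_num : (32 : ℕ) ≠ 0)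
  have hle : (Ideal.span {((32 : ℕ) : 𝓞 K)} : Ideal (𝓞 K)) ≤ Ideal.span {((4 : ℕ) : 𝓞 K)} := by
    rw [Ideal.span_singleton_le_span_singleton]
    exact ⟨(8 : ℕ), by push_cast; norm_num⟩
  -- a primitive 4th root of unity `ζ` in `K̄` has `ζ² = −1`
  obtain ⟨ζ, hζ⟩ := exists_isPrimitiveRoot_rayClassField (K := K) (m := 4) h32 hle
  refine ⟨ζ, ?_⟩
  have h4 : ζ ^ 4 = 1 := hζ.pow_eq_one
  have h2 : ζ ^ 2 ≠ 1 := hζ.pow_ne_one_of_pos_of_lt (by norm_num) (by norm_num)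
  have hfac : (ζ ^ 2 - 1) * (ζ ^ 2 + 1) = 0 := by
    have : ζ ^ 4 - 1 = 0 := by rw [h4, sub_self]
    linear_combination this
  rcases mul_eq_zero.mp hfac with h | h
  · exact absurd (sub_eq_zero.mp h) h2
  · exact eq_neg_of_add_eq_zero_left h

end Summit.BirchSwinnertonDyer.PrintCf2.TheoremAHilbertBridge

end
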